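import Literature.Probability.RandomPlanarGeometry.HexSAWRotStripIdentityY
import Literature.Probability.RandomPlanarGeometry.HexSAWRotTourFrame
import Literature.Probability.RandomPlanarGeometry.HexSAWBridges
import Literature.Probability.RandomPlanarGeometry.HexSAWLemma2
import Literature.Probability.RandomPlanarGeometry.HexSAWHammersleyWelshSix
import Mathlib.Analysis.SpecialFunctions.Pow.Real
import Mathlib.Analysis.MeanInequalities
import HarnessLib

/-!
# Beaton's rotated-frame critical surface fugacity, I: two-variable rotated strip sums, the half-plane boxes, and the elementary faces
# (door (c-rot-print) «HEX-YC-ROT-PRINT» of the lane «pcv-sawmu», tree edition file R1 of 3 — frame twin of `HexSAWSurfaceYcFaces.lean`)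

Topic `Literature/Probability/RandomPlanarGeometry` (continues `HexSAWRotStripIdentityY.lean` — K96.1: `HV.rotGFy`, `HV.topContacts`,
`HV.rotYdagger`, `HV.rotGFy_top_le` — and `HexSAWRotTourFrame.lean` (`HV.reflX`), `HexSAWBridges.lean`).
Sources: N. R. Beaton, *The critical surface fugacity of self-avoiding walks on a rotated honeycomb lattice*, J. Phys. A 47
(2014) 075003, arXiv:1210.0274v3 — Theorem 1 (p. 2: `y_c = √((2+√2)/(1+√2−√(2+√2)))`), §3.1 and Proposition 7 (p. 11: `C_n^+(y)`,
`μ(y)`, `y_c`), §3.2 (Propositions 8–9, Corollary 10, p. 15), §4 (p. 16; Lemma 12 and Proposition 11 p. 17; proof of Proposition 11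
with the last-contact cut, p. 18, Fig. 7); the DCS-frame twin is BBdGDCG14 / Glazman–Manolescu 2020 (tree files `HexSAWSurfaceYc*`).
READING AS PRINTED (a-idea-1 g18, lit-1 g12 07:34Z): (i) `hexRotSurfaceYc` is the RADIUS FORM `sup {y ≥ 0 : ∀ 0 < x < x_c, the
box-truncated C⁺(x,y) is bounded}` = `sup {y ≥ 0 : limsup_n C_n^+(y)^{1/n} ≤ μ}` unconditionally; = Proposition 7's `y_c` granted the
HTW82 existence clause (neither used nor formalised); (ii) the walk model: vertex self-avoiding lists from `a⁺ = hvOrigin` in the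
half-plane `{ξ ≤ 0}`, weight `x^{#vertices} y^{#vertices on ξ = 0}` — Beaton's `m` = the surface count, `n` = the vertex count up to
bounded factors (radii invariant); (iii) the strip side is K96.1's vocabulary verbatim (`HV.rotStripV`, `HV.rotGFy`, `HV.topContacts`,
`IsRotTopDart`), `rotStripGFxy … x_c y = HV.rotGFy …` by `rfl`.  LABEL (lit-1): CONSOLIDATION — Beaton's Theorem 1 by a route not printed
in this frame (Corollary-10-free: no `y_T → y_c` limit, no HTW existence clause), explicit constants, kernel-checked.
DESIGN AND AUTHORSHIP.  Statements and proofs are a-idea-1 gen 18's HOME sketch `Sketch_G18_RotYcPrint.lean` ed.5 (sha16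
490f2f22050d7d50, 2026-08-23) VERBATIM, moved to the tree namespace `…SAW.HV` by the filer lineage a-p6 (gen 8 cut); `TailCount` /
`tailCount_holds` are the tree's (`HexSAWSurfaceYcFaces.lean`, same text).
THIS FILE: vocabulary (`surfCount`, `rotHpV`, `rotHpLists`, `rotHpGF`, `RotHalfPlaneBounded`, `rotYcSet`, `hexRotSurfaceYc`, `rotStripGFxy`
with `rotStripGFxy_xc`, `rotKbeta`) and the faces that are elementary on the tree, each next to its proof: K96.1's bound `RotTopBoundXc`
(`rotTopBoundXc_holds := HV.rotGFy_top_le`), D2ʳ `RotLevelCost`, D4ʳ `RotHoelderXY`, D6ʳ `RotReversalInjection` (top walks reversed and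
reflected into half-plane walks: `rotTopLists`, `revTop`, `revTop_mem`, `revTop_injOn`).  Files R2 (`HexSAWRotSurfaceYcCut.lean`: D1ʳ, the
rotated two-cut decomposition) and R3 (`HexSAWRotSurfaceYc.lean`: glues, D5ʳ from R100, capstone `hexRotSurfaceYc = y†`) continue.
-/

noncomputable section

open Finset Filter Topology

namespace Literature.Probability.RandomPlanarGeometry.SAW.HV

/-! ### Vocabulary -/


/-- Surface contacts of a vertex list in the rotated half-plane: the number of its vertices on the surface row `ξ = 0`
(the starting vertex `a⁺` included, as in Beaton's `m`). [cite: Beaton2014RotatedHoneycomb, §3.1 (arXiv v3 p. 11: "occupying m vertices in the surface")] -/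
def surfCount (l : List HV) : ℕ := (l.filter fun v => xi v = 0).length

/-- The half-plane box `{0 ≤ −ξ ≤ T, |X − 3| < 3L}` (depth `T`, half-width `L`, symmetric under `reflX`).
[cite: Beaton2014RotatedHoneycomb, §2.2 (the rotated frame, D_{T,L}), §3.1 (the half-plane)] -/
def rotHpV (T L : ℕ) : Finset HV :=
  ((Icc (-(T : ℤ) - L - 2) (L + 2)) ×ˢ (Icc (-(L : ℤ) - 2) (L + 2)) ×ˢ (univ : Finset Bool)).filter
    fun v => 0 ≤ -xi v ∧ -xi v ≤ T ∧ |xX v - 3| < 3 * L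

/-- Membership in the half-plane box is the three printed constraints. [cite: Beaton2014RotatedHoneycomb, §2.2] -/
theorem mem_rotHpV_iff {T L : ℕ} {v : HV} : v ∈ rotHpV T L ↔ 0 ≤ -xi v ∧ -xi v ≤ T ∧ |xX v - 3| < 3 * L := by
  obtain ⟨a, b, c⟩ := v
  simp only [rotHpV, mem_filter, mem_product, mem_Icc, mem_univ, and_true]
  constructor
  · exact fun h => h.2
  · intro h
    refine ⟨⟨⟨?_, ?_⟩, ?_, ?_⟩, h⟩ <;> obtain ⟨h1, h2, h3⟩ := h <;> cases c <;>
      simp only [xi, xX, bit_true, bit_false, abs_lt] at h1 h2 h3 ⊢ <;> omega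

/-- **Half-plane walks in a box**: vertex self-avoiding lists from `a⁺` inside `rotHpV T L`.
[cite: Beaton2014RotatedHoneycomb, §3.1 (c^+_n(m))] -/
def rotHpLists (T L : ℕ) : Finset (List HV) :=
  ((range (rotHpV T L).card).biUnion fun n => sawFin hvOrigin n).filter fun l => ∀ v ∈ l, v ∈ rotHpV T L

/-- Membership in `rotHpLists`. [cite: Beaton2014RotatedHoneycomb, §3.1] -/
theorem mem_rotHpLists_iff {T L : ℕ} {l : List HV} :
    l ∈ rotHpLists T L ↔ l.IsChain hvGraph.Adj ∧ l.head? = some hvOrigin ∧ l.Nodup ∧ ∀ v ∈ l, v ∈ rotHpV T L := by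
  rw [rotHpLists, mem_filter, mem_biUnion]
  constructor
  · rintro ⟨⟨n, -, hn⟩, hV⟩
    obtain ⟨hc, hh, -, hnd⟩ := mem_sawLists_iff.1 (mem_sawFin_iff.1 hn)
    exact ⟨hc, hh, hnd, hV⟩
  · rintro ⟨hc, hh, hnd, hV⟩
    have hl : l ≠ [] := by rintro rfl; simp at hh
    have hlen : l.length ≤ (rotHpV T L).card := by
      rw [← List.toFinset_card_of_nodup hnd]
      exact card_le_card fun v hv => hV v (List.mem_toFinset.1 hv)
    have hpos : 0 < l.length := List.length_pos_iff.2 hl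
    refine ⟨⟨l.length - 1, mem_range.2 (by omega), mem_sawFin_iff.2 (mem_sawLists_iff.2 ⟨hc, hh, by omega, hnd⟩)⟩, hV⟩

/-- **`C^+_{T,L}(x, y)`**: the two-variable half-plane generating function of the box. [cite: Beaton2014RotatedHoneycomb, §3.1 (C^+_n(y), arXiv v3 p. 11), Proposition 7 (p. 11)] -/
def rotHpGF (T L : ℕ) (x y : ℝ) : ℝ := ∑ l ∈ rotHpLists T L, x ^ l.length * y ^ surfCount l

/-- Finiteness of the half-plane generating function at `(x, y)`: the box sums are bounded. [cite: Beaton2014RotatedHoneycomb, Proposition 7 (arXiv v3 p. 11)] -/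
def RotHalfPlaneBounded (x y : ℝ) : Prop := BddAbove (Set.range fun p : ℕ × ℕ => rotHpGF p.1 p.2 x y)

/-- The desorbed set `{y ≥ 0 : C^+(x, y) < ∞ for every 0 < x < x_c}`. [cite: Beaton2014RotatedHoneycomb, Proposition 7 (arXiv v3 p. 11: μ(y) = μ iff y ≤ y_c)] -/
def rotYcSet : Set ℝ := {y | 0 ≤ y ∧ ∀ x : ℝ, 0 < x → x < hexCriticalFugacity → RotHalfPlaneBounded x y}

/-- **`y_c` of the rotated surface (LANE DEFINITION, radius form)**: `sup {y ≥ 0 : limsup_n C_n^+(y)^{1/n} ≤ μ}`.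
[cite: Beaton2014RotatedHoneycomb, Proposition 7 (arXiv v3 p. 11), Theorem 1 (p. 2); GlazmanManolescu2019, Definition 1.1 (arXiv v3 p. 5: the definition shape, DCS frame)] -/
def hexRotSurfaceYc : ℝ := sSup rotYcSet

/-- **`B_{H,W}(x; y)` and its sisters**: the two-variable class generating functions of Beaton's `D(H, W)` (K96.1 vocabulary; at `x = x_c`
this is `HV.rotGFy … ` by `rfl`). [cite: Beaton2014RotatedHoneycomb, §2.4 ("Including surface interactions: general y")] -/
def rotStripGFxy (H Wd : ℕ) (cls : HV × HV → Prop) [DecidablePred cls] (x y : ℝ) : ℝ :=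
  ∑ P ∈ (midWalks ((rotStripV H Wd).erase wOut)).filter (fun P => cls (finalDart P)), x ^ mwLen P * y ^ topContacts H P

/-- The dictionary to K96.1 at `x = x_c`. [cite: Beaton2014RotatedHoneycomb, §2.4] -/
theorem rotStripGFxy_xc (H Wd : ℕ) (cls : HV × HV → Prop) [DecidablePred cls] (y : ℝ) :
    rotStripGFxy H Wd cls hexCriticalFugacity y = rotGFy ((rotStripV H Wd).erase wOut) H cls y := rfl

/-- Beaton's bound `K_β(y) := x_c cos(π/16) x_c y (1 + x_c y) / (cos(π/16) − x_c² y² cos(5π/16))` (K96.1 `rotGFy_top_le`).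
[cite: Beaton2014RotatedHoneycomb, §4 (arXiv v3 p. 16), Lemma 12 (p. 17)] -/
def rotKbeta (y : ℝ) : ℝ :=
  hexCriticalFugacity * Real.cos (Real.pi / 16) * (hexCriticalFugacity * y * (1 + hexCriticalFugacity * y)) /
    (Real.cos (Real.pi / 16) - hexCriticalFugacity ^ 2 * y ^ 2 * Real.cos (5 * Real.pi / 16))

/-! ### The faces of this file (each proved below) -/

/-- **INPUT (kernel-done, TREE K96.1 `HV.rotGFy_top_le`): `B_{H,W}(x_c; y) ≤ K_β(y)` for `y < y†`, every `H ≥ 1`, every width.**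
PROVED below from the tree (`rotTopBoundXc_holds`). [cite: Beaton2014RotatedHoneycomb, §4, Lemma 12 (arXiv v3 p. 17)] -/
def RotTopBoundXc : Prop := ∀ (H Wd : ℕ), 1 ≤ H → ∀ y : ℝ, 0 < y → y < rotYdagger →
  rotStripGFxy H Wd (IsRotTopDart H) hexCriticalFugacity y ≤ rotKbeta y

/-- **D2ʳ «ROT-LEVEL-COST» (PROVED below)**: a top walk of `D(H, W)` has at least `H + 1` inner vertices, so `B_{H,W}(x; y) ≤ (x/x_c)^{H+1} B_{H,W}(x_c; y)`
for `x ≤ x_c`. [cite: Beaton2014RotatedHoneycomb, §2.2 ("the height of the domain is the length of the shortest walk starting at a and ending at the top boundary")] -/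
def RotLevelCost : Prop := ∀ (H Wd : ℕ) (x y : ℝ), 0 ≤ x → x ≤ hexCriticalFugacity → 0 ≤ y →
  rotStripGFxy H Wd (IsRotTopDart H) x y ≤ (x / hexCriticalFugacity) ^ (H + 1) * rotStripGFxy H Wd (IsRotTopDart H) hexCriticalFugacity y

/-- **D4ʳ «HÖLDER» (PROVED below)**: `B_{H,W}(x₁^{1−θ}x₂^θ; y₁^{1−θ}y₂^θ) ≤ B_{H,W}(x₁;y₁)^{1−θ} B_{H,W}(x₂;y₂)^θ`.
[cite: Beaton2014RotatedHoneycomb, Proposition 8 (arXiv v3 p. 15: log-convexity)] -/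
def RotHoelderXY : Prop := ∀ (H Wd : ℕ) (x₁ x₂ y₁ y₂ θ : ℝ), 0 < x₁ → 0 < x₂ → 0 < y₁ → 0 < y₂ → 0 < θ → θ < 1 →
  rotStripGFxy H Wd (IsRotTopDart H) (x₁ ^ (1 - θ) * x₂ ^ θ) (y₁ ^ (1 - θ) * y₂ ^ θ) ≤
    rotStripGFxy H Wd (IsRotTopDart H) x₁ y₁ ^ (1 - θ) * rotStripGFxy H Wd (IsRotTopDart H) x₂ y₂ ^ θ

/-- **D6ʳ «ROT-REVERSAL-INJECTION» (OPEN → to be proved below)**: a top walk of `D(H, W+1)` read backwards and reflected is a half-plane walk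
from `a⁺` in a box of depth `H`, with the same length and with top contacts ↦ surface contacts: `B_{H,W+1}(x; y) ≤ C^+_{H,L'}(x, y)`.
[cite: Beaton2014RotatedHoneycomb, §3.2 ("By the symmetry of bridges", arXiv v3 p. 15)] -/
def RotReversalInjection : Prop := ∀ (H Wd : ℕ) (x y : ℝ), 1 ≤ H → 0 ≤ x → 0 ≤ y →
  ∃ L' : ℕ, rotStripGFxy H (Wd + 1) (IsRotTopDart H) x y ≤ rotHpGF H L' x y

/-! ### Elementary facts -/

/-- The rotated class sums are nonnegative for `x, y ≥ 0` (nonnegative coefficients). [cite: Beaton2014RotatedHoneycomb, §2.4 ("Including surface interactions: general y": the strip series with nonnegative coefficients)] -/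
theorem rotStripGFxy_nonneg (H Wd : ℕ) (cls : HV × HV → Prop) [DecidablePred cls] {x y : ℝ} (hx : 0 ≤ x) (hy : 0 ≤ y) :
    0 ≤ rotStripGFxy H Wd cls x y :=
  sum_nonneg fun _ _ => mul_nonneg (pow_nonneg hx _) (pow_nonneg hy _)

/-- The truncated rotated half-plane partition function is nonnegative for `x, y ≥ 0`. [cite: Beaton2014RotatedHoneycomb, §3.1 (C^+_n(y), arXiv v3 p. 11)] -/
theorem rotHpGF_nonneg (T L : ℕ) {x y : ℝ} (hx : 0 ≤ x) (hy : 0 ≤ y) : 0 ≤ rotHpGF T L x y :=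
  sum_nonneg fun _ _ => mul_nonneg (pow_nonneg hx _) (pow_nonneg hy _)

/-- Monotonicity of the class sums in both variables (termwise). [cite: Beaton2014RotatedHoneycomb, §2.4 ("Including surface interactions: general y": the strip series with nonnegative coefficients)] -/
theorem rotStripGFxy_mono (H Wd : ℕ) (cls : HV × HV → Prop) [DecidablePred cls] {x x' y y' : ℝ}
    (hx : 0 ≤ x) (hxx' : x ≤ x') (hy : 0 ≤ y) (hyy' : y ≤ y') :
    rotStripGFxy H Wd cls x y ≤ rotStripGFxy H Wd cls x' y' :=
  sum_le_sum fun _ _ => mul_le_mul (pow_le_pow_left₀ hx hxx' _) (pow_le_pow_left₀ hy hyy' _)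
    (pow_nonneg hy _) (pow_nonneg (hx.trans hxx') _)

/-- `K_β(y) ≥ 0` for `0 < y < y†`. [cite: Beaton2014RotatedHoneycomb, §4 (sign of c_B(y), arXiv v3 p. 16)] -/
theorem rotKbeta_nonneg {y : ℝ} (hy : 0 < y) (hlt : y < rotYdagger) : 0 ≤ rotKbeta y := by
  have h := rotGFy_top_le (le_refl 1) hy hlt 0
  have h0 : 0 ≤ rotGFy ((rotStripV 1 0).erase wOut) 1 (IsRotTopDart 1) y := rotGFy_nonneg _ _ _ hy.le
  exact h0.trans h

/-- `1 < y†` (indeed `x_c y† > 1` since `cos(π/16) > cos(5π/16)`). [cite: Beaton2014RotatedHoneycomb, Proposition 7 (arXiv v3 p. 11: 1 ≤ y_c), Theorem 1 (p. 2: y_c = 2.455…)] -/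
theorem one_lt_rotYdagger : 1 < rotYdagger := by
  obtain ⟨hxc0, hxc1⟩ := hexCriticalFugacity_pos_lt_one
  have hsq := sq_hexCriticalFugacity_mul_rotYdagger
  have hc5 : 0 < Real.cos (5 * Real.pi / 16) :=
    Real.cos_pos_of_mem_Ioo ⟨by linarith [Real.pi_pos], by linarith [Real.pi_pos]⟩
  have hlt : Real.cos (5 * Real.pi / 16) < Real.cos (Real.pi / 16) := by
    apply Real.cos_lt_cos_of_nonneg_of_le_pi_div_two (by linarith [Real.pi_pos]) (by linarith [Real.pi_pos])
    linarith [Real.pi_pos]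
  have hgt : 1 < (hexCriticalFugacity * rotYdagger) ^ 2 := by
    rw [hsq, lt_div_iff₀ hc5]; linarith
  have hpos : 0 < rotYdagger := rotYdagger_pos
  have h1 : 1 < hexCriticalFugacity * rotYdagger := by
    by_contra h
    push Not at h
    have : (hexCriticalFugacity * rotYdagger) ^ 2 ≤ 1 := by
      have h0 : 0 ≤ hexCriticalFugacity * rotYdagger := by positivity
      nlinarith
    linarith
  nlinarith

/-! ### PROVED FACES: K96.1 import, D2ʳ, D4ʳ, `TailCount` -/

/-- **`RotTopBoundXc` holds** — it is the tree's K96.1 `HV.rotGFy_top_le`. [cite: Beaton2014RotatedHoneycomb, §4, Lemma 12 (arXiv v3 p. 17)] -/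
theorem rotTopBoundXc_holds : RotTopBoundXc := fun _ Wd hH _ hy hlt => rotGFy_top_le hH hy hlt Wd

/-- `RotTopBoundXc` — `_holds` alias of `rotTopBoundXc_holds` above under the fact's exact name (appended
2026-08-28, D-0026 bookkeeping: the proof term is the existing theorem of this file; no statement,
definition or attribute is edited; no new named fact; the ledger's debt table listed the fact
unproved). [cite: Beaton2014RotatedHoneycomb, §4, Lemma 12 (arXiv v3 p. 17)] -/
theorem _root_.Literature.Probability.RandomPlanarGeometry.SAW.HV.RotTopBoundXc_holds :
    RotTopBoundXc :=
  _root_.Literature.Probability.RandomPlanarGeometry.SAW.HV.rotTopBoundXc_holds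

/-- The inner list of a TOP walk of `D(H, W)`: anatomy. [cite: Beaton2014RotatedHoneycomb, §2.2] -/
theorem eq_of_isRotTopDart {H Wd : ℕ} (hH : 1 ≤ H) {P : List HV} (hP : IsMidWalk ((rotStripV H Wd).erase wOut) P)
    (hβ : IsRotTopDart H (finalDart P)) :
    ∃ (l : List HV) (u : HV) (hl : l ≠ []), P = wOut :: (l ++ [u]) ∧ xi (l.getLast hl) = -(H : ℤ) ∧ xi u = -(H : ℤ) - 1 := by
  rcases hP.trivial_or_exists with rfl | ⟨l, u, hl, rfl⟩
  · exfalso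
    rw [finalDart_trivial] at hβ
    obtain ⟨h1, -⟩ := hβ
    rw [xi_wOut] at h1
    omega
  · rw [finalDart_cons_append hl] at hβ
    exact ⟨l, u, hl, rfl, hβ.1, hβ.2⟩

/-- A TOP walk of `D(H, W)` has at least `H + 1` inner vertices (`ξ` moves by at most one per step, from `0` to `−H`).
[cite: Beaton2014RotatedHoneycomb, §2.2 ("the height of the domain is the length of the shortest walk starting at a and ending at the top boundary")] -/
theorem succ_le_mwLen_of_isRotTopDart {H Wd : ℕ} (hH : 1 ≤ H) {P : List HV} (hP : IsMidWalk ((rotStripV H Wd).erase wOut) P)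
    (hβ : IsRotTopDart H (finalDart P)) : H + 1 ≤ mwLen P := by
  obtain ⟨l, u, hl, rfl, hlast, -⟩ := eq_of_isRotTopDart hH hP hβ
  obtain ⟨hc, hh, -, -, -, -⟩ := (isMidWalk_cons_append_iff _ hl u).1 hP
  rw [mwLen_cons_append]
  -- `ξ` changes by at most one along the chain
  have key : ∀ (n : ℕ) (hn : n < l.length), -(n : ℤ) ≤ xi (l[n]'hn) := by
    intro n
    induction n with
    | zero =>
      intro hn
      have h0 : l[0] = hvOrigin := by
        rw [List.head?_eq_getElem?, List.getElem?_eq_getElem hn, Option.some_inj] at hh; exact hh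
      rw [h0, xi_hvOrigin]; simp
    | succ n ih =>
      intro hn
      have hadj : hvGraph.Adj (l[n]'(by omega)) (l[n + 1]'hn) := List.isChain_iff_getElem.1 hc n hn
      have h1 := ih (by omega)
      have h2 := xi_adj hadj
      push_cast
      omega
  have hpos : 0 < l.length := List.length_pos_iff.2 hl
  have hlast' := key (l.length - 1) (by omega)
  rw [← List.getLast_eq_getElem hl, hlast] at hlast'
  omega

/-- **D2ʳ holds** (termwise: `x^ℓ = (x/x_c)^ℓ x_c^ℓ ≤ (x/x_c)^{H+1} x_c^ℓ`). [cite: Beaton2014RotatedHoneycomb, §2.2] -/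
theorem rotLevelCost_holds : RotLevelCost := by
  intro H Wd x y hx hxc hy
  have hxc0 : 0 < hexCriticalFugacity := hexCriticalFugacity_pos_lt_one.1
  have hρ0 : 0 ≤ x / hexCriticalFugacity := div_nonneg hx hxc0.le
  have hρ1 : x / hexCriticalFugacity ≤ 1 := (div_le_one hxc0).2 hxc
  rcases Nat.eq_zero_or_pos H with rfl | hH
  · -- `H = 0`: there are no top walks except possibly with one inner vertex; use the termwise bound with exponent `1 ≤ ℓ`? No:
    -- simpler — every term satisfies `x^ℓ ≤ (x/x_c)^ℓ x_c^ℓ ≤ (x/x_c)^{min} …`; we only need `1 ≤ ℓ`, true for any top walk at `H = 0`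
    -- (the trivial walk has final dart `(a⁻, a⁺)` with `ξ a⁺ = 0 ≠ -1`).
    unfold rotStripGFxy
    rw [mul_sum]
    refine sum_le_sum fun P hP => ?_
    obtain ⟨hPm, hβ⟩ := mem_filter.1 hP
    have hP' := mem_midWalks_iff.1 hPm
    have hlen : 0 + 1 ≤ mwLen P := by
      rcases hP'.trivial_or_exists with rfl | ⟨l, u, hl, rfl⟩
      · exfalso
        rw [finalDart_trivial] at hβ
        obtain ⟨-, h2⟩ := hβ
        rw [xi_hvOrigin] at h2
        omega
      · rw [mwLen_cons_append]; exact List.length_pos_iff.2 hl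
    have hxl : x ^ mwLen P = (x / hexCriticalFugacity) ^ mwLen P * hexCriticalFugacity ^ mwLen P := by
      rw [← mul_pow, div_mul_cancel₀ _ hxc0.ne']
    rw [hxl, mul_assoc]
    exact mul_le_mul_of_nonneg_right (pow_le_pow_of_le_one hρ0 hρ1 hlen)
      (mul_nonneg (pow_nonneg hxc0.le _) (pow_nonneg hy _))
  unfold rotStripGFxy
  rw [mul_sum]
  refine sum_le_sum fun P hP => ?_
  obtain ⟨hPm, hβ⟩ := mem_filter.1 hP
  have hlen := succ_le_mwLen_of_isRotTopDart hH (mem_midWalks_iff.1 hPm) hβ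
  have hxl : x ^ mwLen P = (x / hexCriticalFugacity) ^ mwLen P * hexCriticalFugacity ^ mwLen P := by
    rw [← mul_pow, div_mul_cancel₀ _ hxc0.ne']
  rw [hxl, mul_assoc]
  exact mul_le_mul_of_nonneg_right (pow_le_pow_of_le_one hρ0 hρ1 hlen)
    (mul_nonneg (pow_nonneg hxc0.le _) (pow_nonneg hy _))

/-- `RotLevelCost` — `_holds` alias of `rotLevelCost_holds` above under the fact's exact name (appended
2026-08-28, D-0026 bookkeeping: the proof term is the existing theorem of this file; no statement,
definition or attribute is edited; no new named fact; the ledger's debt table listed the fact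
unproved). [cite: Beaton2014RotatedHoneycomb, §2.2] -/
theorem _root_.Literature.Probability.RandomPlanarGeometry.SAW.HV.RotLevelCost_holds :
    RotLevelCost :=
  _root_.Literature.Probability.RandomPlanarGeometry.SAW.HV.rotLevelCost_holds

/-- **D4ʳ holds**: Hölder with exponents `1/(1−θ)`, `1/θ` on the finite sum. [cite: Beaton2014RotatedHoneycomb, Proposition 8 (arXiv v3 p. 15)] -/
theorem rotHoelderXY_holds : RotHoelderXY := by
  intro H Wd x₁ x₂ y₁ y₂ θ hx₁ hx₂ hy₁ hy₂ hθ0 hθ1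
  have h1θ : 0 < 1 - θ := by linarith
  have hpq : (1 / (1 - θ)).HolderConjugate (1 / θ) := Real.holderConjugate_one_div h1θ hθ0 (by ring)
  have hcomm : ∀ {a : ℝ}, 0 ≤ a → ∀ (r : ℝ) (n : ℕ), (a ^ r) ^ n = (a ^ n) ^ r := fun ha r n => by
    rw [← Real.rpow_mul_natCast ha, mul_comm r (n : ℝ), Real.rpow_natCast_mul ha]
  have hsplit : ∀ P : List HV,
      (x₁ ^ (1 - θ) * x₂ ^ θ) ^ mwLen P * (y₁ ^ (1 - θ) * y₂ ^ θ) ^ topContacts H P =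
        (x₁ ^ mwLen P * y₁ ^ topContacts H P) ^ (1 - θ) * (x₂ ^ mwLen P * y₂ ^ topContacts H P) ^ θ := by
    intro P
    rw [mul_pow, mul_pow, hcomm hx₁.le, hcomm hx₂.le, hcomm hy₁.le, hcomm hy₂.le,
      Real.mul_rpow (pow_nonneg hx₁.le _) (pow_nonneg hy₁.le _),
      Real.mul_rpow (pow_nonneg hx₂.le _) (pow_nonneg hy₂.le _)]
    ring
  unfold rotStripGFxy
  simp_rw [hsplit]
  set s := (midWalks ((rotStripV H Wd).erase wOut)).filter (fun P => IsRotTopDart H (finalDart P)) with hs_def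
  have hH := Real.inner_le_Lp_mul_Lq_of_nonneg s hpq
    (f := fun P => (x₁ ^ mwLen P * y₁ ^ topContacts H P) ^ (1 - θ))
    (g := fun P => (x₂ ^ mwLen P * y₂ ^ topContacts H P) ^ θ)
    (fun P _ => Real.rpow_nonneg (mul_nonneg (pow_nonneg hx₁.le _) (pow_nonneg hy₁.le _)) _)
    (fun P _ => Real.rpow_nonneg (mul_nonneg (pow_nonneg hx₂.le _) (pow_nonneg hy₂.le _)) _)
  have hf : ∀ P : List HV, ((x₁ ^ mwLen P * y₁ ^ topContacts H P) ^ (1 - θ)) ^ (1 / (1 - θ)) =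
      x₁ ^ mwLen P * y₁ ^ topContacts H P := fun P => by
    rw [← Real.rpow_mul (mul_nonneg (pow_nonneg hx₁.le _) (pow_nonneg hy₁.le _)), mul_one_div_cancel h1θ.ne',
      Real.rpow_one]
  have hg : ∀ P : List HV, ((x₂ ^ mwLen P * y₂ ^ topContacts H P) ^ θ) ^ (1 / θ) =
      x₂ ^ mwLen P * y₂ ^ topContacts H P := fun P => by
    rw [← Real.rpow_mul (mul_nonneg (pow_nonneg hx₂.le _) (pow_nonneg hy₂.le _)), mul_one_div_cancel hθ0.ne',
      Real.rpow_one]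
  simp only [hf, hg, one_div_one_div] at hH
  exact hH

/-- `RotHoelderXY` — `_holds` alias of `rotHoelderXY_holds` above under the fact's exact name (appended
2026-08-28, D-0026 bookkeeping: the proof term is the existing theorem of this file; no statement,
definition or attribute is edited; no new named fact; the ledger's debt table listed the fact
unproved). [cite: Beaton2014RotatedHoneycomb, Proposition 8 (arXiv v3 p. 15)] -/
theorem _root_.Literature.Probability.RandomPlanarGeometry.SAW.HV.RotHoelderXY_holds :
    RotHoelderXY :=
  _root_.Literature.Probability.RandomPlanarGeometry.SAW.HV.rotHoelderXY_holds

/-! ### D6ʳ PROVED: top lists of `D(H, W)`, the reversal–reflection map, `B_{H,W}(x; y) ≤ C^+_{H,L'}(x, y)` -/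

section Reversal

variable {H Wd : ℕ}

/-- The inner vertex lists of the TOP walks of `D(H, W)` (self-avoiding lists from `a⁺` in `D(H, W) ∖ {a⁻}` ending on the top row `ξ = −H`).
[cite: Beaton2014RotatedHoneycomb, §2.2 (walks a → β)] -/
def rotTopLists (H Wd : ℕ) : Finset (List HV) :=
  ((midWalks ((rotStripV H Wd).erase wOut)).filter fun P => IsRotTopDart H (finalDart P)).image inner

/-- `ξ`-bounds inside `D(H, W) ∖ {a⁻}`. [cite: Beaton2014RotatedHoneycomb, §2.2] -/
theorem xi_bounds_of_mem_erase {v : HV} (hv : v ∈ (rotStripV H Wd).erase wOut) : -(H : ℤ) ≤ xi v ∧ xi v ≤ 0 :=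
  xi_bounds_of_mem_rotStripV (mem_of_mem_erase hv)

/-- Membership in `rotTopLists` (the exit vertex is the forced `xiDown` of the last vertex). [cite: Beaton2014RotatedHoneycomb, §2.2] -/
theorem mem_rotTopLists_iff (hH : 1 ≤ H) {l : List HV} :
    l ∈ rotTopLists H Wd ↔ l.IsChain hvGraph.Adj ∧ l.head? = some hvOrigin ∧ l.Nodup ∧
      (∀ x ∈ l, x ∈ (rotStripV H Wd).erase wOut) ∧ ∃ h : l ≠ [], xi (l.getLast h) = -(H : ℤ) := by
  rw [rotTopLists, mem_image]
  constructor
  · rintro ⟨P, hP, rfl⟩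
    rw [mem_filter, mem_midWalks_iff] at hP
    obtain ⟨l, u, hl, rfl, hlast, -⟩ := eq_of_isRotTopDart hH hP.1 hP.2
    rw [inner_cons_append]
    obtain ⟨hc, hh, -, hV, hnd, -⟩ := (isMidWalk_cons_append_iff _ hl _).1 hP.1
    exact ⟨hc, hh, hnd, hV, hl, hlast⟩
  · rintro ⟨hc, hh, hnd, hV, hl, hlast⟩
    refine ⟨wOut :: (l ++ [xiDown (l.getLast hl)]), ?_, inner_cons_append _ _⟩
    have hx : xi (xiDown (l.getLast hl)) = -(H : ℤ) - 1 := by rw [xi_xiDown, hlast]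
    rw [mem_filter, mem_midWalks_iff, isMidWalk_cons_append_iff _ hl, finalDart_cons_append hl]
    refine ⟨⟨hc, hh, adj_xiDown _, hV, hnd, ?_⟩, hlast, hx⟩
    intro h
    rcases prevOf_mem l with h' | h'
    · rw [h, h', xi_wOut] at hx; omega
    · have := (xi_bounds_of_mem_erase (hV _ h')).1
      rw [← h] at this; omega

/-- `Σ` over the TOP walks of a function of the inner list = `Σ` over `rotTopLists` (the exit vertex is determined: `Δξ = −1` forces `xiDown`).
[cite: Beaton2014RotatedHoneycomb, §2.2] -/
theorem sum_top_eq_sum_rotTopLists (hH : 1 ≤ H) (g : List HV → ℝ) :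
    ∑ P ∈ (midWalks ((rotStripV H Wd).erase wOut)).filter (fun P => IsRotTopDart H (finalDart P)), g (inner P)
      = ∑ l ∈ rotTopLists H Wd, g l := by
  rw [rotTopLists, sum_image]
  intro P hP P' hP' h
  rw [mem_coe, mem_filter, mem_midWalks_iff] at hP hP'
  obtain ⟨l, u, hl, rfl, hlast, hu⟩ := eq_of_isRotTopDart hH hP.1 hP.2
  obtain ⟨l', u', hl', rfl, hlast', hu'⟩ := eq_of_isRotTopDart hH hP'.1 hP'.2
  simp only [inner_cons_append] at h
  subst h
  have hadj := ((isMidWalk_cons_append_iff _ hl u).1 hP.1).2.2.1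
  have hadj' := ((isMidWalk_cons_append_iff _ hl u').1 hP'.1).2.2.1
  have e1 : u = xiDown (l.getLast hl) := (eq_xiDown_or_xiSide_of_adj hadj).1 (by rw [hu, hlast])
  have e2 : u' = xiDown (l.getLast hl) := (eq_xiDown_or_xiSide_of_adj hadj').1 (by rw [hu', hlast'])
  rw [e1, e2]

/-- `B_{H,W}(x; y)` as a sum over top lists. [cite: Beaton2014RotatedHoneycomb, §2.4 ("Including surface interactions: general y")] -/
theorem rotStripGFxy_top_eq (hH : 1 ≤ H) (x y : ℝ) :
    rotStripGFxy H Wd (IsRotTopDart H) x y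
      = ∑ l ∈ rotTopLists H Wd, x ^ l.length * y ^ (l.filter fun v => xi v = -(H : ℤ)).length := by
  rw [rotStripGFxy, ← sum_top_eq_sum_rotTopLists hH]
  refine sum_congr rfl fun P hP => ?_
  rw [mem_filter, mem_midWalks_iff] at hP
  rw [← hP.1.length_inner, topContacts, List.countP_eq_length_filter]

/-- The point reflection followed by a `ξ`-shift: `σ_{H,a} := shift(a, −H − 2a) ∘ flip`, a graph automorphism of `ℍ` with `ξ ∘ σ = −H − ξ`
(it exchanges the surface row `ξ = 0` and the top row `ξ = −H`). [cite: Beaton2014RotatedHoneycomb, §3.2 ("By the symmetry of bridges", arXiv v3 p. 15)] -/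
def rsig (H : ℕ) (a : ℤ) : hvGraph ≃g hvGraph := HV.flip.trans (shift a (-(H : ℤ) - 2 * a))

/-- `σ_{H,a}` in coordinates. [cite: Beaton2014RotatedHoneycomb, §3.2 ("By the symmetry of bridges", arXiv v3 p. 15)] -/
@[simp] theorem rsig_apply (H : ℕ) (a : ℤ) (v : HV) : rsig H a v = (-v.1 + a, -v.2.1 - 1 + (-(H : ℤ) - 2 * a), !v.2.2) := rfl

/-- `σ_{H,a}` followed by the axis reflection `reflX` (`X ↦ 6 − X`, `ξ` fixed). [cite: Beaton2014RotatedHoneycomb, §2.2 (reflection symmetry of D_{T,L})] -/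
def rsigR (H : ℕ) (a : ℤ) : hvGraph ≃g hvGraph := (rsig H a).trans reflX

/-- `rsigR` in terms of `rsig` and `reflX`. [cite: Beaton2014RotatedHoneycomb, §2.2 (the rotated domains D_{T,L} and their reflection symmetry)] -/
theorem rsigR_apply' (H : ℕ) (a : ℤ) (v : HV) : rsigR H a v = reflX (rsig H a v) := rfl

/-- Heights under `rsig`: `ξ ↦ −H − ξ`. [cite: Beaton2014RotatedHoneycomb, §3.2 ("By the symmetry of bridges", arXiv v3 p. 15)] -/
@[simp] theorem xi_rsig (H : ℕ) (a : ℤ) (v : HV) : xi (rsig H a v) = -(H : ℤ) - xi v := by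
  obtain ⟨p, q, c⟩ := v; cases c <;> simp [xi, bit] <;> ring

/-- Heights under `rsigR`: `ξ ↦ −H − ξ`. [cite: Beaton2014RotatedHoneycomb, §3.2 ("By the symmetry of bridges", arXiv v3 p. 15)] -/
@[simp] theorem xi_rsigR (H : ℕ) (a : ℤ) (v : HV) : xi (rsigR H a v) = -(H : ℤ) - xi v := by
  rw [rsigR_apply', xi_reflX, xi_rsig]

/-- Abscissae under `rsig`. [cite: Beaton2014RotatedHoneycomb, §2.2 (the rotated domains D_{T,L} and their reflection symmetry)] -/
@[simp] theorem xX_rsig (H : ℕ) (a : ℤ) (v : HV) : xX (rsig H a v) = 6 - 3 * H - 6 * a - xX v := by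
  obtain ⟨p, q, c⟩ := v; cases c <;> simp [xX, bit] <;> ring

/-- Abscissae under `rsigR`. [cite: Beaton2014RotatedHoneycomb, §2.2 (the rotated domains D_{T,L} and their reflection symmetry)] -/
@[simp] theorem xX_rsigR (H : ℕ) (a : ℤ) (v : HV) : xX (rsigR H a v) = 3 * H + 6 * a + xX v := by
  rw [rsigR_apply', xX_reflX, xX_rsig]; ring

/-- **The normalised reflection** `N_{H,c,a}`: `σ_{H,a}` if `c = true`, `reflX ∘ σ_{H,a}` if `c = false` — chosen so that a top-row vertex `w`
(`ξ w = −H`) of type `c` and abscissa `a` is sent to `a⁺`. [cite: Beaton2014RotatedHoneycomb, §3.2 (symmetry of bridges)] -/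
def nmap (H : ℕ) (c : Bool) (a : ℤ) : hvGraph ≃g hvGraph := cond c (rsig H a) (rsigR H a)

/-- `nmap H true a = rsig H a`. [cite: Beaton2014RotatedHoneycomb, §3.2 ("By the symmetry of bridges", arXiv v3 p. 15)] -/
@[simp] theorem nmap_true (H : ℕ) (a : ℤ) : nmap H true a = rsig H a := rfl
/-- `nmap H false a = rsigR H a`. [cite: Beaton2014RotatedHoneycomb, §3.2 ("By the symmetry of bridges", arXiv v3 p. 15)] -/
@[simp] theorem nmap_false (H : ℕ) (a : ℤ) : nmap H false a = rsigR H a := rfl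

/-- Heights under the normalisation map: `ξ ↦ −H − ξ`. [cite: Beaton2014RotatedHoneycomb, §3.2 ("By the symmetry of bridges", arXiv v3 p. 15)] -/
theorem xi_nmap (H : ℕ) (c : Bool) (a : ℤ) (v : HV) : xi (nmap H c a v) = -(H : ℤ) - xi v := by
  cases c
  · rw [nmap_false, xi_rsigR]
  · rw [nmap_true, xi_rsig]

/-- `N` sends its reference top-row vertex to `a⁺`. [cite: Beaton2014RotatedHoneycomb, §3.2 ("By the symmetry of bridges", arXiv v3 p. 15)] -/
theorem nmap_self (H : ℕ) {w : HV} (hw : xi w = -(H : ℤ)) : nmap H w.2.2 w.1 w = hvOrigin := by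
  obtain ⟨p, q, c⟩ := w
  cases c
  · simp only [nmap_false, rsigR_apply', rsig_apply, reflX_apply, hvOrigin, xi, bit_false, bit_true, Bool.not_false,
      Bool.not_true] at hw ⊢
    refine Prod.ext ?_ (Prod.ext ?_ rfl) <;> dsimp only <;> omega
  · simp only [nmap_true, rsig_apply, hvOrigin, xi, bit_true, Bool.not_true] at hw ⊢
    refine Prod.ext ?_ (Prod.ext ?_ rfl) <;> dsimp only <;> omega

/-- The parameters `(c, a)` are read off the image of `a⁺`. [cite: Beaton2014RotatedHoneycomb, §3.2 ("By the symmetry of bridges", arXiv v3 p. 15)] -/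
theorem nmap_hvOrigin_inj (H : ℕ) {c₁ c₂ : Bool} {a₁ a₂ : ℤ} (h : nmap H c₁ a₁ hvOrigin = nmap H c₂ a₂ hvOrigin) :
    c₁ = c₂ ∧ a₁ = a₂ := by
  cases c₁ <;> cases c₂ <;>
    simp only [nmap_false, nmap_true, rsigR_apply', rsig_apply, reflX_apply, hvOrigin, Prod.mk.injEq, bit_true,
      Bool.not_false, Bool.not_true] at h <;>
    first | exact ⟨rfl, by omega⟩ | (exfalso; simp at h)

/-- The last vertex of a list (junk `a⁺` for `[]`). [folklore] -/
def lastV (l : List HV) : HV := l.getLast?.getD hvOrigin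

/-- **The reversal map of the rotated frame**: reverse the top list and apply the normalised reflection of its endpoint.
[cite: Beaton2014RotatedHoneycomb, §3.2 ("By the symmetry of bridges", arXiv v3 p. 15)] -/
def revTop (H : ℕ) (l : List HV) : List HV := l.reverse.map (nmap H (lastV l).2.2 (lastV l).1)

/-- The reversal preserves the number of vertices. [cite: Beaton2014RotatedHoneycomb, §3.2 ("By the symmetry of bridges", arXiv v3 p. 15)] -/
@[simp] theorem length_revTop (H : ℕ) (l : List HV) : (revTop H l).length = l.length := by simp [revTop]

/-- The reversal turns top-row vertices into surface vertices, bijectively. [cite: Beaton2014RotatedHoneycomb, §3.2] -/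
theorem surfCount_revTop (H : ℕ) (l : List HV) : surfCount (revTop H l) = (l.filter fun v => xi v = -(H : ℤ)).length := by
  rw [surfCount, revTop, List.filter_map, List.length_map, List.filter_reverse, List.length_reverse]
  congr 1
  refine List.filter_congr fun v _ => ?_
  simp only [Function.comp_apply, xi_nmap, decide_eq_decide]
  omega

/-- A top list is `a⁺ :: Q`, and its last vertex is an interior top-row vertex. [cite: Beaton2014RotatedHoneycomb, §2.2] -/
theorem anatomy_of_mem_rotTopLists (hH : 1 ≤ H) {l : List HV} (hl : l ∈ rotTopLists H Wd) :
    ∃ (Q : List HV) (hne : l ≠ []), l = hvOrigin :: Q ∧ lastV l = l.getLast hne ∧ xi (lastV l) = -(H : ℤ) ∧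
      |xX (lastV l) - 3| < 3 * Wd := by
  obtain ⟨-, hh, -, hV, hne, hlast⟩ := (mem_rotTopLists_iff hH).1 hl
  have hLV : lastV l = l.getLast hne := by rw [lastV, List.getLast?_eq_some_getLast hne, Option.getD_some]
  obtain ⟨Q, rfl⟩ : ∃ Q, l = hvOrigin :: Q := by
    match l, hh with
    | v :: Q, hh => simp only [List.head?_cons, Option.some.injEq] at hh; exact ⟨Q, by rw [hh]⟩
  refine ⟨Q, hne, rfl, hLV, by rw [hLV, hlast], ?_⟩
  have hw := hV _ (List.getLast_mem hne)
  rw [← hLV] at hw hlast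
  rcases mem_rotStripV_iff.1 (mem_of_mem_erase hw) with h | h | h
  · exact absurd h (ne_of_mem_erase hw)
  · rw [h, xi_hvOrigin] at hlast; omega
  · exact h.2.2

/-- The last vertex of the reversed list is `N(a⁺)`. [cite: Beaton2014RotatedHoneycomb, §3.2 ("By the symmetry of bridges", arXiv v3 p. 15)] -/
theorem getLast?_revTop (hH : 1 ≤ H) {l : List HV} (hl : l ∈ rotTopLists H Wd) :
    (revTop H l).getLast? = some (nmap H (lastV l).2.2 (lastV l).1 hvOrigin) := by
  obtain ⟨Q, -, rfl, -⟩ := anatomy_of_mem_rotTopLists hH hl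
  rw [revTop, List.reverse_cons, List.map_append, List.map_singleton]
  simp

/-- **The reversed top list is a half-plane list of the box of depth `H` and half-width `3H + 3W + 9`.**
[cite: Beaton2014RotatedHoneycomb, §3.2 ("By the symmetry of bridges", arXiv v3 p. 15)] -/
theorem revTop_mem (hH : 1 ≤ H) {l : List HV} (hl : l ∈ rotTopLists H Wd) : revTop H l ∈ rotHpLists H (3 * H + 3 * Wd + 9) := by
  obtain ⟨Q, hne, hQ, hLV, hxiw, hXw⟩ := anatomy_of_mem_rotTopLists hH hl
  obtain ⟨hc, hh, hnd, hV, -, -⟩ := (mem_rotTopLists_iff hH).1 hl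
  set φ := nmap H (lastV l).2.2 (lastV l).1 with hφ
  rw [mem_rotHpLists_iff]
  refine ⟨?_, ?_, ?_, ?_⟩
  · rw [revTop, List.isChain_map, List.isChain_reverse]
    exact hc.imp fun u v (h : hvGraph.Adj u v) => (φ.map_rel_iff.2 h).symm
  · rw [revTop, List.head?_map, List.head?_reverse, List.getLast?_eq_some_getLast hne, Option.map_some, ← hLV]
    exact congrArg some (nmap_self H hxiw)
  · exact (List.nodup_reverse.2 hnd).map φ.injective
  · intro v hv
    rw [revTop, List.mem_map] at hv
    obtain ⟨u, hu, rfl⟩ := hv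
    rw [List.mem_reverse] at hu
    have hu' := hV u hu
    have hξu := xi_bounds_of_mem_erase hu'
    -- the abscissa of the endpoint is controlled by its `ξ` and `X`
    have ha : |(lastV l).1| ≤ H + Wd + 2 := by
      revert hxiw hXw
      generalize lastV l = w
      intro hxiw hXw
      obtain ⟨p, q, c⟩ := w
      cases c <;> simp only [xi, xX, bit_true, bit_false, abs_lt, abs_le] at hxiw hXw ⊢ <;> omega
    have hXu : |xX u - 3| < 3 * Wd ∨ u = hvOrigin := by
      rcases mem_rotStripV_iff.1 (mem_of_mem_erase hu') with h | h | h
      · exact absurd h (ne_of_mem_erase hu')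
      · exact Or.inr h
      · exact Or.inl h.2.2
    rw [mem_rotHpV_iff, ← hφ]
    have hξ' : xi (φ u) = -(H : ℤ) - xi u := xi_nmap _ _ _ _
    have hX' : xX (φ u) = 6 - 3 * H - 6 * (lastV l).1 - xX u ∨ xX (φ u) = 3 * H + 6 * (lastV l).1 + xX u := by
      rw [hφ]; cases (lastV l).2.2
      · exact Or.inr (by rw [nmap_false, xX_rsigR])
      · exact Or.inl (by rw [nmap_true, xX_rsig])
    rw [abs_le] at ha
    rcases hXu with hXu | rfl
    · rw [abs_lt] at hXu ⊢
      rcases hX' with hX' | hX' <;> rw [hX', hξ'] <;> refine ⟨by omega, by omega, by push_cast; omega⟩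
    · rw [xX_hvOrigin, xi_hvOrigin] at *
      rw [abs_lt]
      rcases hX' with hX' | hX' <;> rw [hX', hξ'] <;> refine ⟨by omega, by omega, by push_cast; omega⟩

/-- **The reversal map is injective on the top lists of `D(H, W)`** (the parameters of `N` are read off the image's last vertex).
[cite: Beaton2014RotatedHoneycomb, §3.2] -/
theorem revTop_injOn (hH : 1 ≤ H) : Set.InjOn (revTop H) (rotTopLists H Wd : Set (List HV)) := by
  intro l₁ h₁ l₂ h₂ h
  rw [mem_coe] at h₁ h₂
  have e := congrArg List.getLast? h
  rw [getLast?_revTop hH h₁, getLast?_revTop hH h₂, Option.some_inj] at e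
  obtain ⟨hc, ha⟩ := nmap_hvOrigin_inj H e
  unfold revTop at h
  rw [hc, ha] at h
  exact List.reverse_inj.1 ((List.map_injective_iff.2 (nmap H _ _).injective) h)

/-- The top lists, weighted by their TOP-ROW vertices, inject into the half-plane lists weighted by their SURFACE vertices.
[cite: Beaton2014RotatedHoneycomb, §3.1–3.2] -/
theorem sum_rotTopLists_le_rotHpGF (hH : 1 ≤ H) {x y : ℝ} (hx : 0 ≤ x) (hy : 0 ≤ y) :
    ∑ l ∈ rotTopLists H Wd, x ^ l.length * y ^ (l.filter fun v => xi v = -(H : ℤ)).length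
      ≤ rotHpGF H (3 * H + 3 * Wd + 9) x y := by
  calc ∑ l ∈ rotTopLists H Wd, x ^ l.length * y ^ (l.filter fun v => xi v = -(H : ℤ)).length
      = ∑ l ∈ rotTopLists H Wd, (fun g : List HV => x ^ g.length * y ^ surfCount g) (revTop H l) := by
        refine sum_congr rfl fun l _ => ?_
        simp only [length_revTop, surfCount_revTop]
    _ ≤ ∑ g ∈ rotHpLists H (3 * H + 3 * Wd + 9), x ^ g.length * y ^ surfCount g :=
        sum_le_sum_of_injOn_of_nonneg (revTop H) (revTop_injOn hH) (fun l hl => revTop_mem hH hl)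
          (fun g : List HV => x ^ g.length * y ^ surfCount g) fun g _ => mul_nonneg (pow_nonneg hx _) (pow_nonneg hy _)

end Reversal

/-- **D6ʳ `RotReversalInjection` HOLDS**: `B_{H,W+1}(x; y) ≤ C^+_{H,3H+3W+12}(x, y)`. [cite: Beaton2014RotatedHoneycomb, §3.2 ("By the symmetry of bridges", arXiv v3 p. 15)] -/
theorem rotReversalInjection_holds : RotReversalInjection := by
  intro H Wd x y hH hx hy
  refine ⟨3 * H + 3 * (Wd + 1) + 9, ?_⟩
  rw [rotStripGFxy_top_eq hH]
  exact sum_rotTopLists_le_rotHpGF hH hx hy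

/-- `RotReversalInjection` — `_holds` alias of `rotReversalInjection_holds` above under the fact's exact name (appended
2026-08-28, D-0026 bookkeeping: the proof term is the existing theorem of this file; no statement,
definition or attribute is edited; no new named fact; the ledger's debt table listed the fact
unproved). [cite: Beaton2014RotatedHoneycomb, §3.2 ("By the symmetry of bridges", arXiv v3 p. 15)] -/
theorem _root_.Literature.Probability.RandomPlanarGeometry.SAW.HV.RotReversalInjection_holds :
    RotReversalInjection :=
  _root_.Literature.Probability.RandomPlanarGeometry.SAW.HV.rotReversalInjection_holds

end Literature.Probability.RandomPlanarGeometry.SAW.HV
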